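import Summits.QuantumFields.BalabanUV.Beta.GAN24.AveragedPropagatorDefectFields

/-!
# G-an2-4 ∕ (CONV-C), road P2, route R2-S1, VECTOR LAYER, PART 5 — THE ONE-STEP SUP LAW OF THE VECTOR UNIT-LATTICE CONSTITUENT
# `c_n = Q_n𝒢_nQ_n*` MODULO THE FIVE VECTOR SUP LETTERS OF `𝒢 = Δ_a⁻¹` (zeroth, `∇𝒢`, `𝒢∇ᴴ`, `∇∇𝒢`, `𝒢∇ᴴ∇ᴴ`) — NO letter for `P`, `Δ⁻¹`,
# `Δ⁻²`, `(Q′Δ⁻²Q′*)⁻¹`: `|((c_{RN} − c_N)g)(y)| ≤ ((R−1)∕(RN))·K(letters)·|g|_∞`, every `d`, every torus, every `a > 0`, `N, R ≥ 1`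

Unit `b2b-balaban-gan24-p2` (gen 30), BINDER row G-an2-4 ∕ (CONV-C), road P2; crux team (2).  Parts 2–4 (`StaircaseAveragingDefect`,
`AveragedPropagatorTwoLevel`, `AveragedPropagatorDefectFields`) give the exact identity `c′ − c = Q′𝒢′E₂ + E₁𝒢Q* − Q′𝒢′·𝔇·𝒢Q*` with every
defect LOCAL and written in the currency of the vector letters.  THIS FILE is the triangle inequality:
 * §1 three term bounds for an ARBITRARY fine operator `G′` carrying the displayed letters: **`norm_G_Lap_defect_le`** (`d·ρ·(C₃′B₂ + C₁′B₄)`),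
   **`norm_G_gradDiv_defect_le`** (`ρ·(d²C₃′B₂ + d²C₁′B₄)`), **`norm_G_Pi_defect_le`** (`3ρ·C₀′·B₀`), `ρ = (R−1)∕(RN)`;
 * §2 **`norm_covOp_succ_sub_mulVec_le_of_letters`** — THE END: for letters `C₀` (`‖𝒢_N‖_{∞→∞}`), `C₀′` (`‖𝒢_{RN}‖`), `C₁′` (`‖𝒢_{RN}∇ᴴ‖`),
   `C₂` (`‖∇𝒢_N‖`), `C₃′` (`‖𝒢_{RN}∇ᴴ∇ᴴ‖`), `C₄` (`‖∇∇𝒢_N‖`) DISPLAYED as sup → sup hypotheses, every `g` with `|g| ≤ b` and every unit bond `i`: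
   `‖((c_{RN} − c_N)g)(i)‖ ≤ ((R−1)∕(RN))·(2C₀′ + C₀ + (d + d²)(C₃′C₂ + C₁′C₄) + 3a·C₀′C₀)·b`.
The letters are theorems of the tree at `a = 1` on CUBIC unit tori (`B5G115SupBound`, `Entry115SupCubic`, `Entry112SupLogCubicFlat` — `C₃′`, `C₄`
carry `1 + log n`); the UNCONDITIONAL cubic corollary is Part 6 (`AveragedPropagatorOneStepCubic`).
HONEST SCOPE.  Triangle inequalities over Parts 2–4; `U = 1`, vector, the unit-lattice-read constituent only; letters DISPLAYED (no `def … : Prop`,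
no named fact); [folklore]; kernel-checked, no `sorry`.  [Balaban1984PropagatorsI] (1.99), (1.110)∕(1.115) pp. 35–36 are TEXT LOCATIONS.  NOT (CONV-C)
as typed, NEVER «G-an2-4 closed», NOT NE2, NOT D1, NOT BetaPertH, NOT continuum, NOT Clay; not in print — our proof.  HONEST DEPENDENCY: continuum YM
on T⁴ ⇐ BetaPertH ∧ nine spine estimates (0/9 proved); BetaPertH ⇐ (D1) ∧ (D4) ∧ CAP+tail; G-an2-4 gates asym, D1 and NE2/3/4.
-/

noncomputable section

open scoped BigOperators ComplexConjugate Matrix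

namespace Summit.QuantumFields.BalabanUV.Beta.GAN24.AveragedPropagatorOneStepSup

open Literature.MathematicalPhysics.QuantumFieldTheory.Balaban1983to89
open B5Prop11Plancherel (Tor fine unitVec fdiff shiftM)
open B5Prop11Lower (Lap)
open B5Action121 (GradOp)
open B5Block118 (QvOp)
open B5DeltaA169 (DeltaA QvAdj)
open Summit.QuantumFields.BalabanUV.Beta.GAN24.StaircaseAveragingDefect (stairV fwdDefect adjDefect ratio_nonneg norm_fwdDefect_mulVec_le
  norm_adjDefect_mulVec_le norm_QvOp_mulVec_le norm_QvAdj_mulVec_le)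
open Summit.QuantumFields.BalabanUV.Beta.GAN24.AveragedPropagatorTwoLevel (covOp locOp covOp_succ_sub locOp_stairV_defect)
open Summit.QuantumFields.BalabanUV.Beta.GAN24.AveragedPropagatorDefectFields

variable {d : ℕ} (N R : ℕ) [NeZero N] [NeZero R] (M : Fin d → ℕ) [hM : ∀ μ, NeZero (M μ)]

/-! ## §1 Term bounds for a fine operator carrying the letters -/

section Terms

variable (G' : Matrix (Tor (fine (R * N) M) × Fin d) (Tor (fine (R * N) M) × Fin d) ℂ) {C₀' C₁' C₃' : ℝ}

/-- a sum of `d` bounded terms. [folklore] -/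
theorem norm_sum_fin_le {f : Fin d → ℂ} {B : ℝ} (h : ∀ ν, ‖f ν‖ ≤ B) : ‖∑ ν, f ν‖ ≤ d * B :=
  (norm_sum_le _ _).trans (by
    calc ∑ ν, ‖f ν‖ ≤ ∑ _ν : Fin d, B := Finset.sum_le_sum fun ν _ => h ν
      _ = d * B := by rw [Finset.sum_const, Finset.card_univ, Fintype.card_fin, nsmul_eq_mul])

/-- **THE LAPLACIAN-DEFECT TERM**: `|G′((Lap′J − JLap)u)| ≤ d·ρ·(C₃′·sup|∇u| + C₁′·sup|∇∇u|)`. [folklore] -/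
theorem norm_G_Lap_defect_le
    (hG1' : ∀ (ν : Fin d) (F : Tor (fine (R * N) M) × Fin d → ℂ) (B : ℝ), (∀ j, ‖F j‖ ≤ B) →
      ∀ i, ‖(G' *ᵥ ((fdiff (fine (R * N) M) ((R * N : ℕ) : ℂ) ν)ᴴ *ᵥ F)) i‖ ≤ C₁' * B)
    (hG3' : ∀ (μ ν : Fin d) (F : Tor (fine (R * N) M) × Fin d → ℂ) (B : ℝ), (∀ j, ‖F j‖ ≤ B) →
      ∀ i, ‖(G' *ᵥ ((fdiff (fine (R * N) M) ((R * N : ℕ) : ℂ) μ)ᴴ *ᵥ ((fdiff (fine (R * N) M) ((R * N : ℕ) : ℂ) ν)ᴴ *ᵥ F))) i‖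
        ≤ C₃' * B)
    (u : Tor (fine N M) × Fin d → ℂ) {B₂ B₄ : ℝ}
    (h2 : ∀ ν j, ‖(fdiff (fine N M) (N : ℂ) ν *ᵥ u) j‖ ≤ B₂)
    (h4 : ∀ ν j, ‖(fdiff (fine N M) (N : ℂ) ν *ᵥ (fdiff (fine N M) (N : ℂ) ν *ᵥ u)) j‖ ≤ B₄)
    (i : Tor (fine (R * N) M) × Fin d) :
    ‖(G' *ᵥ ((Lap (R * N) M * stairV N R M - stairV N R M * Lap N M) *ᵥ u)) i‖
      ≤ d * ((((R : ℝ) - 1) / ((R : ℝ) * N)) * (C₃' * B₂ + C₁' * B₄)) := by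
  rw [Lap_defect_mulVec, Matrix.mulVec_sum, Finset.sum_apply]
  refine norm_sum_fin_le fun ν => ?_
  rw [Matrix.mulVec_add, Matrix.mulVec_add, Pi.add_apply]
  refine (norm_add_le _ _).trans ?_
  have hA := hG3' ν ν (PhiL N R M ν u) _ (fun j => norm_PhiL_le N R M ν u (h2 ν) j) i
  have hB := hG1' ν (PsiF N R M ν u) _ (fun j => norm_PsiF_le N R M ν u (h4 ν) j) i
  calc _ ≤ C₃' * ((((R : ℝ) - 1) / ((R : ℝ) * N)) * B₂) + C₁' * ((((R : ℝ) - 1) / ((R : ℝ) * N)) * B₄) := add_le_add hA hB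
    _ = _ := by ring

/-- **THE GRAD-DIV-DEFECT TERM**: `|G′((∂′∂′ᴴJ − J∂∂ᴴ)u)| ≤ ρ·(d²·C₃′·sup|∇u| + d²·C₁′·sup|∇∇u|)` (the mixed `∇′∇′ᴴ` moved onto the `∇′ᴴ∇′ᴴ` letter
by `fdiff_fdiffH_eq_shift`). [folklore] -/
theorem norm_G_gradDiv_defect_le
    (hG1' : ∀ (ν : Fin d) (F : Tor (fine (R * N) M) × Fin d → ℂ) (B : ℝ), (∀ j, ‖F j‖ ≤ B) →
      ∀ i, ‖(G' *ᵥ ((fdiff (fine (R * N) M) ((R * N : ℕ) : ℂ) ν)ᴴ *ᵥ F)) i‖ ≤ C₁' * B)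
    (hG3' : ∀ (μ ν : Fin d) (F : Tor (fine (R * N) M) × Fin d → ℂ) (B : ℝ), (∀ j, ‖F j‖ ≤ B) →
      ∀ i, ‖(G' *ᵥ ((fdiff (fine (R * N) M) ((R * N : ℕ) : ℂ) μ)ᴴ *ᵥ ((fdiff (fine (R * N) M) ((R * N : ℕ) : ℂ) ν)ᴴ *ᵥ F))) i‖
        ≤ C₃' * B)
    (u : Tor (fine N M) × Fin d → ℂ) {B₂ B₄ : ℝ}
    (h2 : ∀ ν j, ‖(fdiff (fine N M) (N : ℂ) ν *ᵥ u) j‖ ≤ B₂)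
    (h4 : ∀ μ ν j, ‖(fdiff (fine N M) (N : ℂ) ν *ᵥ (fdiff (fine N M) (N : ℂ) μ *ᵥ u)) j‖ ≤ B₄)
    (i : Tor (fine (R * N) M) × Fin d) :
    ‖(G' *ᵥ ((GradOp (fine (R * N) M) ((R * N : ℕ) : ℂ) * (GradOp (fine (R * N) M) ((R * N : ℕ) : ℂ))ᴴ * stairV N R M
        - stairV N R M * (GradOp (fine N M) ((N : ℕ) : ℂ) * (GradOp (fine N M) ((N : ℕ) : ℂ))ᴴ)) *ᵥ u)) i‖
      ≤ (((R : ℝ) - 1) / ((R : ℝ) * N)) * (d * (d * (C₃' * B₂)) + d * (C₁' * (d * B₄))) := by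
  rw [gradDiv_defect_mulVec, Matrix.mulVec_add, Pi.add_apply, Matrix.mulVec_sum, Finset.sum_apply, Matrix.mulVec_sum, Finset.sum_apply]
  have hV : ‖∑ ν, ∑ μ, (G' *ᵥ (fdiff (fine (R * N) M) ((R * N : ℕ) : ℂ) μ *ᵥ
      ((fdiff (fine (R * N) M) ((R * N : ℕ) : ℂ) ν)ᴴ *ᵥ emb μ (phiF N R M ν u)))) i‖
      ≤ d * (d * (C₃' * ((((R : ℝ) - 1) / ((R : ℝ) * N)) * B₂))) := by
    refine norm_sum_fin_le fun ν => norm_sum_fin_le fun μ => ?_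
    rw [fdiff_fdiffH_eq_shift]
    have hφ : ∀ j, ‖(-(shiftM (fine (R * N) M) μ *ᵥ emb μ (phiF N R M ν u))) j‖ ≤ (((R : ℝ) - 1) / ((R : ℝ) * N)) * B₂ :=
      norm_neg_shiftM_mulVec_le μ _ (norm_emb_le μ _ (norm_phiF_le N R M ν u (h2 ν)))
    exact hG3' μ ν _ _ hφ i
  have hW : ‖∑ μ, (G' *ᵥ ((fdiff (fine (R * N) M) ((R * N : ℕ) : ℂ) μ)ᴴ *ᵥ emb μ (phiLdiv N R M μ u))) i‖
      ≤ d * (C₁' * ((((R : ℝ) - 1) / ((R : ℝ) * N)) * (d * B₄))) := by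
    refine norm_sum_fin_le fun μ => ?_
    have hφ : ∀ j, ‖emb μ (phiLdiv N R M μ u) j‖ ≤ (((R : ℝ) - 1) / ((R : ℝ) * N)) * (d * B₄) :=
      norm_emb_le μ _ (norm_phiLdiv_le N R M μ u h4)
    exact hG1' μ _ _ hφ i
  have hV' : ‖∑ ν, (G' *ᵥ ∑ μ, (fdiff (fine (R * N) M) ((R * N : ℕ) : ℂ) μ *ᵥ
      ((fdiff (fine (R * N) M) ((R * N : ℕ) : ℂ) ν)ᴴ *ᵥ emb μ (phiF N R M ν u)))) i‖
      ≤ d * (d * (C₃' * ((((R : ℝ) - 1) / ((R : ℝ) * N)) * B₂))) := by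
    have e : (∑ ν, (G' *ᵥ ∑ μ, (fdiff (fine (R * N) M) ((R * N : ℕ) : ℂ) μ *ᵥ
        ((fdiff (fine (R * N) M) ((R * N : ℕ) : ℂ) ν)ᴴ *ᵥ emb μ (phiF N R M ν u)))) i)
        = ∑ ν, ∑ μ, (G' *ᵥ (fdiff (fine (R * N) M) ((R * N : ℕ) : ℂ) μ *ᵥ
            ((fdiff (fine (R * N) M) ((R * N : ℕ) : ℂ) ν)ᴴ *ᵥ emb μ (phiF N R M ν u)))) i :=
      Finset.sum_congr rfl fun ν _ => by rw [Matrix.mulVec_sum, Finset.sum_apply]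
    rw [e]; exact hV
  calc _ ≤ d * (d * (C₃' * ((((R : ℝ) - 1) / ((R : ℝ) * N)) * B₂))) + d * (C₁' * ((((R : ℝ) - 1) / ((R : ℝ) * N)) * (d * B₄))) :=
        norm_add_le_of_le hV' hW
    _ = _ := by ring

/-- **THE MASS-TERM DEFECT**: `|G′((E₂Q + Q′*E₁)u)| ≤ 3ρ·C₀′·sup|u|`. [folklore] -/
theorem norm_G_Pi_defect_le
    (hG0' : ∀ (F : Tor (fine (R * N) M) × Fin d → ℂ) (B : ℝ), (∀ j, ‖F j‖ ≤ B) → ∀ i, ‖(G' *ᵥ F) i‖ ≤ C₀' * B)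
    (u : Tor (fine N M) × Fin d → ℂ) {B₀ : ℝ} (h0 : ∀ j, ‖u j‖ ≤ B₀) (i : Tor (fine (R * N) M) × Fin d) :
    ‖(G' *ᵥ ((adjDefect N R M * QvOp N M + QvAdj (R * N) M * fwdDefect N R M) *ᵥ u)) i‖
      ≤ 3 * ((((R : ℝ) - 1) / ((R : ℝ) * N)) * (C₀' * B₀)) := by
  rw [Matrix.add_mulVec, ← Matrix.mulVec_mulVec, ← Matrix.mulVec_mulVec, Matrix.mulVec_add, Pi.add_apply]
  have hA : ‖(G' *ᵥ (adjDefect N R M *ᵥ (QvOp N M *ᵥ u))) i‖ ≤ C₀' * (2 * (((R : ℝ) - 1) / ((R : ℝ) * N)) * B₀) :=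
    hG0' _ _ (norm_adjDefect_mulVec_le N R M _ _ (norm_QvOp_mulVec_le M N u B₀ h0)) i
  have hB : ‖(G' *ᵥ (QvAdj (R * N) M *ᵥ (fwdDefect N R M *ᵥ u))) i‖ ≤ C₀' * ((((R : ℝ) - 1) / ((R : ℝ) * N)) * B₀) :=
    hG0' _ _ (norm_QvAdj_mulVec_le M (R * N) _ _ (norm_fwdDefect_mulVec_le N R M u B₀ h0)) i
  calc _ ≤ C₀' * (2 * (((R : ℝ) - 1) / ((R : ℝ) * N)) * B₀) + C₀' * ((((R : ℝ) - 1) / ((R : ℝ) * N)) * B₀) := norm_add_le_of_le hA hB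
    _ = _ := by ring

end Terms

/-! ## §2 The END modulo the five vector letters -/

/-- **THE ONE-STEP SUP LAW OF THE VECTOR UNIT-LATTICE CONSTITUENT `c_n = Q_n𝒢_nQ_n*`, MODULO THE VECTOR LETTERS** (every `d`, every torus
`M`, every `a > 0`, `N, R ≥ 1`): given sup → sup bounds `C₀` of `𝒢_N`, `C₀′` of `𝒢_{RN}`, `C₁′` of `𝒢_{RN}∇_νᴴ`, `C₂` of `∇_ν𝒢_N`, `C₃′` of
`𝒢_{RN}∇_μᴴ∇_νᴴ`, `C₄` of `∇_μ∇_ν𝒢_N` (DISPLAYED hypotheses; the tree has them at `a = 1` on cubic tori, `C₃′, C₄` with `1 + log n`), for every unit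
bond field `g` with `|g| ≤ b` and every unit bond `i`:
`‖((c_{RN} − c_N)g)(i)‖ ≤ ((R−1)∕(RN))·(2C₀′ + C₀ + (d + d²)(C₃′C₂ + C₁′C₄) + 3a·C₀′C₀)·b`. [folklore] -/
theorem norm_covOp_succ_sub_mulVec_le_of_letters {a : ℝ} (ha : 0 < a) {C₀ C₀' C₁' C₂ C₃' C₄ : ℝ}
    (hG0 : ∀ (F : Tor (fine N M) × Fin d → ℂ) (B : ℝ), (∀ j, ‖F j‖ ≤ B) → ∀ i, ‖((DeltaA N M a)⁻¹ *ᵥ F) i‖ ≤ C₀ * B)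
    (hG0' : ∀ (F : Tor (fine (R * N) M) × Fin d → ℂ) (B : ℝ), (∀ j, ‖F j‖ ≤ B) →
      ∀ i, ‖((DeltaA (R * N) M a)⁻¹ *ᵥ F) i‖ ≤ C₀' * B)
    (hG1' : ∀ (ν : Fin d) (F : Tor (fine (R * N) M) × Fin d → ℂ) (B : ℝ), (∀ j, ‖F j‖ ≤ B) →
      ∀ i, ‖((DeltaA (R * N) M a)⁻¹ *ᵥ ((fdiff (fine (R * N) M) ((R * N : ℕ) : ℂ) ν)ᴴ *ᵥ F)) i‖ ≤ C₁' * B)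
    (hG2 : ∀ (ν : Fin d) (F : Tor (fine N M) × Fin d → ℂ) (B : ℝ), (∀ j, ‖F j‖ ≤ B) →
      ∀ i, ‖(fdiff (fine N M) (N : ℂ) ν *ᵥ ((DeltaA N M a)⁻¹ *ᵥ F)) i‖ ≤ C₂ * B)
    (hG3' : ∀ (μ ν : Fin d) (F : Tor (fine (R * N) M) × Fin d → ℂ) (B : ℝ), (∀ j, ‖F j‖ ≤ B) →
      ∀ i, ‖((DeltaA (R * N) M a)⁻¹ *ᵥ ((fdiff (fine (R * N) M) ((R * N : ℕ) : ℂ) μ)ᴴ *ᵥ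
        ((fdiff (fine (R * N) M) ((R * N : ℕ) : ℂ) ν)ᴴ *ᵥ F))) i‖ ≤ C₃' * B)
    (hG4 : ∀ (μ ν : Fin d) (F : Tor (fine N M) × Fin d → ℂ) (B : ℝ), (∀ j, ‖F j‖ ≤ B) →
      ∀ i, ‖(fdiff (fine N M) (N : ℂ) μ *ᵥ (fdiff (fine N M) (N : ℂ) ν *ᵥ ((DeltaA N M a)⁻¹ *ᵥ F))) i‖ ≤ C₄ * B)
    (g : Tor M × Fin d → ℂ) (b : ℝ) (hg : ∀ j, ‖g j‖ ≤ b) (i : Tor M × Fin d) :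
    ‖((covOp (R * N) M a - covOp N M a) *ᵥ g) i‖
      ≤ (((R : ℝ) - 1) / ((R : ℝ) * N))
          * (2 * C₀' + C₀ + ((d : ℝ) + d ^ 2) * (C₃' * C₂ + C₁' * C₄) + 3 * a * (C₀' * C₀)) * b := by
  have hρ := ratio_nonneg N R
  set ρ : ℝ := ((R : ℝ) - 1) / ((R : ℝ) * N) with hρdef
  set G' := (DeltaA (R * N) M a)⁻¹
  set G := (DeltaA N M a)⁻¹
  -- the fine field `u = 𝒢Q*g` and its letters
  set u : Tor (fine N M) × Fin d → ℂ := G *ᵥ (QvAdj N M *ᵥ g) with hu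
  have hQg : ∀ j, ‖(QvAdj N M *ᵥ g) j‖ ≤ b := norm_QvAdj_mulVec_le M N g b hg
  have hu0 : ∀ j, ‖u j‖ ≤ C₀ * b := hG0 _ _ hQg
  have hu2 : ∀ ν j, ‖(fdiff (fine N M) (N : ℂ) ν *ᵥ u) j‖ ≤ C₂ * b := fun ν => hG2 ν _ _ hQg
  have hu4 : ∀ μ ν j, ‖(fdiff (fine N M) (N : ℂ) ν *ᵥ (fdiff (fine N M) (N : ℂ) μ *ᵥ u)) j‖ ≤ C₄ * b :=
    fun μ ν => hG4 ν μ _ _ hQg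
  -- the identity, applied to `g`
  rw [covOp_succ_sub N R M a ha, locOp_stairV_defect]
  rw [Matrix.sub_mulVec, Matrix.add_mulVec, Pi.sub_apply, Pi.add_apply]
  -- T1 = Q′𝒢′E₂g
  have hT1 : ‖((QvOp (R * N) M * G' * adjDefect N R M) *ᵥ g) i‖ ≤ C₀' * (2 * ρ * b) := by
    rw [← Matrix.mulVec_mulVec, ← Matrix.mulVec_mulVec]
    exact norm_QvOp_mulVec_le M (R * N) _ _ (hG0' _ _ (norm_adjDefect_mulVec_le N R M g b hg)) i
  -- T2 = E₁u
  have hT2 : ‖((fwdDefect N R M * G * QvAdj N M) *ᵥ g) i‖ ≤ ρ * (C₀ * b) := by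
    rw [← Matrix.mulVec_mulVec, ← Matrix.mulVec_mulVec]
    exact norm_fwdDefect_mulVec_le N R M u _ hu0 i
  -- T3 = Q′𝒢′𝔇u
  have hT3 : ‖((QvOp (R * N) M * G'
      * ((Lap (R * N) M * stairV N R M - stairV N R M * Lap N M)
          - (GradOp (fine (R * N) M) ((R * N : ℕ) : ℂ) * (GradOp (fine (R * N) M) ((R * N : ℕ) : ℂ))ᴴ * stairV N R M
              - stairV N R M * (GradOp (fine N M) ((N : ℕ) : ℂ) * (GradOp (fine N M) ((N : ℕ) : ℂ))ᴴ))
          + (a : ℂ) • (adjDefect N R M * QvOp N M + QvAdj (R * N) M * fwdDefect N R M))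
      * G * QvAdj N M) *ᵥ g) i‖
      ≤ d * (ρ * (C₃' * (C₂ * b) + C₁' * (C₄ * b))) + ρ * (d * (d * (C₃' * (C₂ * b))) + d * (C₁' * (d * (C₄ * b))))
        + a * (3 * (ρ * (C₀' * (C₀ * b)))) := by
    rw [← Matrix.mulVec_mulVec, ← Matrix.mulVec_mulVec, ← Matrix.mulVec_mulVec, ← Matrix.mulVec_mulVec]
    refine norm_QvOp_mulVec_le M (R * N) _ _ (fun j => ?_) i
    rw [Matrix.add_mulVec, Matrix.sub_mulVec, Matrix.smul_mulVec, Matrix.mulVec_add, Matrix.mulVec_sub, Matrix.mulVec_smul,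
      Pi.add_apply, Pi.sub_apply, Pi.smul_apply]
    refine norm_add_le_of_le (norm_sub_le_of_le ?_ ?_) ?_
    · exact norm_G_Lap_defect_le N R M G' hG1' hG3' u (fun ν => hu2 ν) (fun ν => hu4 ν ν) j
    · exact norm_G_gradDiv_defect_le N R M G' hG1' hG3' u hu2 hu4 j
    · rw [norm_smul, Complex.norm_real, Real.norm_of_nonneg ha.le]
      exact mul_le_mul_of_nonneg_left (norm_G_Pi_defect_le N R M G' hG0' u hu0 j) ha.le
  calc _ ≤ C₀' * (2 * ρ * b) + ρ * (C₀ * b)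
        + (d * (ρ * (C₃' * (C₂ * b) + C₁' * (C₄ * b))) + ρ * (d * (d * (C₃' * (C₂ * b))) + d * (C₁' * (d * (C₄ * b))))
            + a * (3 * (ρ * (C₀' * (C₀ * b))))) := norm_sub_le_of_le (norm_add_le_of_le hT1 hT2) hT3
    _ = ρ * (2 * C₀' + C₀ + ((d : ℝ) + d ^ 2) * (C₃' * C₂ + C₁' * C₄) + 3 * a * (C₀' * C₀)) * b := by ring

end Summit.QuantumFields.BalabanUV.Beta.GAN24.AveragedPropagatorOneStepSup

end
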